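import Mathlib.LinearAlgebra.Span.Basic
import Literature.Computability.AlgebraicComplexity.ArithCircuit
import Literature.Computability.AlgebraicComplexity.CircuitDepth
import HarnessLib

/-!
# Gate-by-gate semantics of arithmetic circuits: values, product-depths, operands

(Model: `Literature.Computability.AlgebraicComplexity.ArithCircuit`, Bürgisser 2000, Def. 2.1;
product-depth: Limaye–Srinivasan–Tavenas, J. ACM 72 (2025), Art. 26, §1.)

The tree's circuit semantics `ArithCircuit.gateValues` and depth lists `ArithCircuit.gateWDepths`
are *total left folds* over the gate list. For arguments that proceed gate by gate (such as the
rank-measure induction of LST 2025, §5, which we run directly on the values of the gates) one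
needs the per-gate form of these folds:

* `gateVal P i` / `gatePD P i` — the value and the product-depth of gate `i` (junk `0` out of
  range), and `opVal P i u` / `opPD P i u` — the value and product-depth of an operand `u` *as seen
  by gate `i`* (a reference `gate j` reads gate `j` if `j < i` and the junk value `0` otherwise);
* `gateVal_of_prod`, `gateVal_of_sum` — gate `i` computes the product / weighted sum of the values
  of its operands; `opPD_succ_le_gatePD_of_prod`, `opPD_le_gatePD_of_sum` — a product gate has
  product-depth one more than each operand, a sum gate at least that of each operand;
* `eval_eq_opVal_output`, `productDepth_eq_opPD_output` — the circuit's output and product-depth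
  in the same terms;
* `gateVal_mem_span_spanFamily` — **sum closure**: the value of every gate is a `k`-linear
  combination of the values of the *product* gates of at most the same product-depth, of the
  variables, and of `1` (a sum gate is a linear combination of its operands; iterate).

Everything is proved from the definitions (prefix lemmas `gateValues_take_eq_take`,
`gateWDepths_take_eq_take` for the folds); no named facts. The circuit is called `P` throughout
(`C` is `MvPolynomial.C`).

## Duplicates elsewhere in the tree (librarian item)

The value-side of this file duplicates, over the SAME trunk model (`ArithCircuit.gateValues`,
`Gate k σ`, `Operand k σ`), the `Semantics` section of
`Literature/Barriers/ValiantsHypothesis/MonotoneGapParseTrees.lean` (namespace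
`Literature.Barriers.ValiantsHypothesis.JerrumSnir`, ll. 130–200): `JerrumSnir.gateVal` =
`gateVal` (there on a gate list `gs`, here on `P.gates`), `JerrumSnir.opVal` = `opVal` with its
unfolding lemmas `opVal_var` / `opVal_const` / `opVal_gate`, `JerrumSnir.gateValues_take` =
`gateValues_take_eq_take` (here without the hypothesis `j ≤ gs.length`),
`JerrumSnir.gateVal_eq_eval` = `gateValues_getElem?` / `gateVal_of_prod` / `gateVal_of_sum`,
`JerrumSnir.gateVal_of_none` = `gateVal_of_le`. A trunk file must not import a `Barriers/`
lower-bound file, so THIS file is the survivor; librarian item: make `MonotoneGapParseTrees.lean`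
import `CircuitGateSemantics` and drop its `Semantics` section (the definitions are literally
identical modulo `P.gates` vs `gs`, so the refactor is mechanical). The depth side (`gatePD`,
`opPD`, `gateWDepths_*`) and the sum-closure lemma have no counterpart there.

## References

* P. Bürgisser, *Completeness and Reduction in Algebraic Complexity Theory*, Springer 2000,
  Def. 2.1 (straight-line programs).
* N. Limaye, S. Srinivasan, S. Tavenas, J. ACM 72 (2025), Art. 26, §1–§2 (product-depth), §7,
  proof of Lemma 19, eq. (1) (a gate of product-depth `Δ` is a sum of products of gates of
  smaller product-depth).
-/

noncomputable section

open MvPolynomial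

namespace Literature.Computability.AlgebraicComplexity

universe u v

namespace ArithCircuit

variable {k : Type u} {σ : Type v}

/-! ### Prefix lemmas for the two folds -/

section Folds

variable [CommSemiring k]

/-- The value list of a prefix of the gate list is the prefix of the value list (each gate is
evaluated against the values of the gates before it only; Bürgisser 2000, Def. 2.1). Duplicate
(without the length hypothesis) of `JerrumSnir.gateValues_take` in
`Barriers/ValiantsHypothesis/MonotoneGapParseTrees.lean`; this trunk copy is the survivor.
[cite: Burgisser2000, Def. 2.1] -/
theorem gateValues_take_eq_take (gs : List (Gate k σ)) (i : ℕ) :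
    gateValues (gs.take i) = (gateValues gs).take i := by
  induction gs using List.reverseRecOn generalizing i with
  | nil => simp [gateValues]
  | append_singleton gs g ih =>
    by_cases hi : i ≤ gs.length
    · rw [List.take_append_of_le_length hi, ih, gateValues_append_singleton,
        List.take_append_of_le_length (by rwa [gateValues_length])]
    · push Not at hi
      have h1 : (gs ++ [g]).take i = gs ++ [g] :=
        List.take_of_length_le (by simp; omega)
      have h2 : (gateValues (gs ++ [g])).take i = gateValues (gs ++ [g]) :=
        List.take_of_length_le (by rw [gateValues_length]; simp; omega)
      rw [h1, h2]

/-- **Per-gate semantics**: the value of gate `i` is its gate function applied to the values of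
the gates before it (Bürgisser 2000, Def. 2.1). [cite: Burgisser2000, Def. 2.1] -/
theorem gateValues_getElem? (gs : List (Gate k σ)) (i : ℕ) (g : Gate k σ) (hg : gs[i]? = some g) :
    (gateValues gs)[i]? = some (g.eval (gateValues (gs.take i))) := by
  have hi : i < gs.length := (List.getElem?_eq_some_iff.1 hg).1
  have h := gateValues_take_eq_take gs (i + 1)
  rw [List.take_add_one, hg, Option.toList_some, gateValues_append_singleton] at h
  have hlen : (gateValues (gs.take i)).length = i := by
    rw [gateValues_length, List.length_take, min_eq_left hi.le]
  have lhs : (gateValues (gs.take i) ++ [g.eval (gateValues (gs.take i))])[i]? =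
      some (g.eval (gateValues (gs.take i))) := by
    rw [List.getElem?_append_right (by omega), hlen, Nat.sub_self, List.getElem?_cons_zero]
  rw [h, List.getElem?_take, if_pos (Nat.lt_succ_self i)] at lhs
  exact lhs

end Folds

section DepthFolds

/-- The depth list of a prefix of the gate list is the prefix of the depth list
(LST 2025, §1). [cite: LimayeSrinivasanTavenas2025, §1] -/
theorem gateWDepths_take_eq_take (w : Gate k σ → ℕ) (gs : List (Gate k σ)) (i : ℕ) :
    gateWDepths w (gs.take i) = (gateWDepths w gs).take i := by
  induction gs using List.reverseRecOn generalizing i with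
  | nil => simp [gateWDepths]
  | append_singleton gs g ih =>
    by_cases hi : i ≤ gs.length
    · rw [List.take_append_of_le_length hi, ih, gateWDepths_append_singleton,
        List.take_append_of_le_length (by rwa [gateWDepths_length])]
    · push Not at hi
      have h1 : (gs ++ [g]).take i = gs ++ [g] :=
        List.take_of_length_le (by simp; omega)
      have h2 : (gateWDepths w (gs ++ [g])).take i = gateWDepths w (gs ++ [g]) :=
        List.take_of_length_le (by rw [gateWDepths_length]; simp; omega)
      rw [h1, h2]

/-- **Per-gate depth**: the weighted depth of gate `i` is its weight plus the maximal depth of its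
operands, read against the depths of the gates before it (LST 2025, §1).
[cite: LimayeSrinivasanTavenas2025, §1] -/
theorem gateWDepths_getElem? (w : Gate k σ → ℕ) (gs : List (Gate k σ)) (i : ℕ) (g : Gate k σ)
    (hg : gs[i]? = some g) :
    (gateWDepths w gs)[i]? =
      some (w g + ((g.args.map (Operand.depthIn (gateWDepths w (gs.take i)))).foldr max 0)) := by
  have hi : i < gs.length := (List.getElem?_eq_some_iff.1 hg).1
  have h := gateWDepths_take_eq_take w gs (i + 1)
  rw [List.take_add_one, hg, Option.toList_some, gateWDepths_append_singleton] at h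
  have hlen : (gateWDepths w (gs.take i)).length = i := by
    rw [gateWDepths_length, List.length_take, min_eq_left hi.le]
  set x := w g + ((g.args.map (Operand.depthIn (gateWDepths w (gs.take i)))).foldr max 0)
  have lhs : (gateWDepths w (gs.take i) ++ [x])[i]? = some x := by
    rw [List.getElem?_append_right (by omega), hlen, Nat.sub_self, List.getElem?_cons_zero]
  rw [h, List.getElem?_take, if_pos (Nat.lt_succ_self i)] at lhs
  exact lhs

/-- An element of a list of naturals is at most its `foldr max 0`. [folklore] -/
theorem le_foldr_max_of_mem {l : List ℕ} {x : ℕ} (hx : x ∈ l) : x ≤ l.foldr max 0 := by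
  induction l with
  | nil => simp at hx
  | cons a l ih =>
    rw [List.foldr_cons]
    rcases List.mem_cons.1 hx with rfl | h
    · exact le_max_left _ _
    · exact (ih h).trans (le_max_right _ _)

end DepthFolds

/-! ### Values and product-depths of gates and operands -/

section GateData

/-- The weight defining the product-depth: product gates weigh `1`, sum gates `0`
(LST 2025, §1). [cite: LimayeSrinivasanTavenas2025, §1] -/
def prodWeight (g : Gate k σ) : ℕ := if g.isProd then 1 else 0

/-- The product-depth of gate number `i` of `P` (junk `0` out of range) (LST 2025, §1).
[cite: LimayeSrinivasanTavenas2025, §1] -/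
def gatePD (P : ArithCircuit k σ) (i : ℕ) : ℕ := (gateWDepths prodWeight P.gates).getD i 0

/-- The product-depth of an operand *as seen by gate `i`*: `0` for variables, constants and junk
references, the product-depth of gate `j` for a reference `gate j` with `j < i` (LST 2025, §1).
[cite: LimayeSrinivasanTavenas2025, §1] -/
def opPD (P : ArithCircuit k σ) (i : ℕ) : Operand k σ → ℕ
  | .var _ => 0
  | .const _ => 0
  | .gate j => if j < i then P.gatePD j else 0

/-- `productDepth` is the `prodWeight`-weighted depth (unfolding).
[cite: LimayeSrinivasanTavenas2025, §1] -/
theorem productDepth_eq_wdepth_prodWeight (P : ArithCircuit k σ) :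
    P.productDepth = P.wdepth prodWeight := rfl

/-- Unfolding `opPD` on a gate reference. [cite: LimayeSrinivasanTavenas2025, §1] -/
@[simp]
theorem opPD_gate (P : ArithCircuit k σ) (i j : ℕ) :
    P.opPD i (.gate j) = if j < i then P.gatePD j else 0 := rfl

/-- Unfolding `opPD` on a variable. [cite: LimayeSrinivasanTavenas2025, §1] -/
@[simp]
theorem opPD_var (P : ArithCircuit k σ) (i : ℕ) (v : σ) : P.opPD i (.var v) = 0 := rfl

/-- Unfolding `opPD` on a constant. [cite: LimayeSrinivasanTavenas2025, §1] -/
@[simp]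
theorem opPD_const (P : ArithCircuit k σ) (i : ℕ) (c : k) : P.opPD i (.const c) = 0 := rfl

/-- Reading an operand's depth against the first `i` gate depths is `opPD P i`.
[cite: LimayeSrinivasanTavenas2025, §1] -/
theorem depthIn_gateWDepths_take (P : ArithCircuit k σ) (i : ℕ) (u : Operand k σ) :
    u.depthIn (gateWDepths prodWeight (P.gates.take i)) = P.opPD i u := by
  cases u with
  | var v => rfl
  | const c => rfl
  | gate j =>
    change (gateWDepths prodWeight (P.gates.take i)).getD j 0 = if j < i then P.gatePD j else 0
    rw [gateWDepths_take_eq_take, List.getD_eq_getElem?_getD, List.getElem?_take]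
    split_ifs with h
    · rw [gatePD, List.getD_eq_getElem?_getD]
    · rfl

/-- **A product gate has product-depth one more than each of its operands** (LST 2025, §1).
[cite: LimayeSrinivasanTavenas2025, §1] -/
theorem opPD_succ_le_gatePD_of_prod (P : ArithCircuit k σ) {i : ℕ} {args : List (Operand k σ)}
    (hg : P.gates[i]? = some (.prod args)) {u : Operand k σ} (hu : u ∈ args) :
    P.opPD i u + 1 ≤ P.gatePD i := by
  unfold gatePD
  rw [List.getD_eq_getElem?_getD, gateWDepths_getElem? prodWeight P.gates i _ hg,
    Option.getD_some]
  simp only [prodWeight, Gate.isProd, if_true, Gate.args]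
  rw [add_comm (1 : ℕ)]
  refine Nat.add_le_add_right (le_foldr_max_of_mem ?_) 1
  rw [← depthIn_gateWDepths_take]
  exact List.mem_map.2 ⟨u, hu, rfl⟩

/-- **A sum gate has product-depth at least that of each of its operands** (LST 2025, §1).
[cite: LimayeSrinivasanTavenas2025, §1] -/
theorem opPD_le_gatePD_of_sum (P : ArithCircuit k σ) {i : ℕ} {args : List (k × Operand k σ)}
    (hg : P.gates[i]? = some (.sum args)) {a : k × Operand k σ} (ha : a ∈ args) :
    P.opPD i a.2 ≤ P.gatePD i := by
  unfold gatePD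
  rw [List.getD_eq_getElem?_getD, gateWDepths_getElem? prodWeight P.gates i _ hg,
    Option.getD_some]
  simp only [prodWeight, Gate.isProd, Gate.args, List.map_map, Bool.false_eq_true, if_false,
    zero_add]
  refine le_foldr_max_of_mem ?_
  rw [← depthIn_gateWDepths_take]
  exact List.mem_map.2 ⟨a, ha, rfl⟩

/-- The product-depth of `P` is the product-depth of its output operand as seen after all gates
(LST 2025, §1). [cite: LimayeSrinivasanTavenas2025, §1] -/
theorem productDepth_eq_opPD_output (P : ArithCircuit k σ) :
    P.productDepth = P.opPD P.size P.output := by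
  rw [productDepth_eq_wdepth_prodWeight, wdepth, ← depthIn_gateWDepths_take, size,
    List.take_length]

variable [CommSemiring k]

/-- The value of gate number `i` of `P` (junk `0` out of range) (Bürgisser 2000, Def. 2.1).
Same object as `JerrumSnir.gateVal` of `Barriers/ValiantsHypothesis/MonotoneGapParseTrees.lean`
(on `P.gates`); this trunk copy is the survivor. [cite: Burgisser2000, Def. 2.1] -/
def gateVal (P : ArithCircuit k σ) (i : ℕ) : MvPolynomial σ k := (gateValues P.gates).getD i 0

/-- The value of an operand *as seen by gate `i`*: variables and constants denote themselves, a
reference `gate j` denotes the value of gate `j` if `j < i` and the junk value `0` otherwise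
(Bürgisser 2000, Def. 2.1). Same object as `JerrumSnir.opVal` of
`Barriers/ValiantsHypothesis/MonotoneGapParseTrees.lean`; this trunk copy is the survivor.
[cite: Burgisser2000, Def. 2.1] -/
def opVal (P : ArithCircuit k σ) (i : ℕ) : Operand k σ → MvPolynomial σ k
  | .var v => X v
  | .const c => MvPolynomial.C c
  | .gate j => if j < i then P.gateVal j else 0

/-- Unfolding `opVal` on a gate reference. [cite: Burgisser2000, Def. 2.1] -/
@[simp]
theorem opVal_gate (P : ArithCircuit k σ) (i j : ℕ) :
    P.opVal i (.gate j) = if j < i then P.gateVal j else 0 := rfl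

/-- Unfolding `opVal` on a variable. [cite: Burgisser2000, Def. 2.1] -/
@[simp]
theorem opVal_var (P : ArithCircuit k σ) (i : ℕ) (v : σ) : P.opVal i (.var v) = X v := rfl

/-- Unfolding `opVal` on a constant. [cite: Burgisser2000, Def. 2.1] -/
@[simp]
theorem opVal_const (P : ArithCircuit k σ) (i : ℕ) (c : k) :
    P.opVal i (.const c) = MvPolynomial.C c := rfl

/-- Reading an operand against the first `i` gate values is `opVal P i`.
[cite: Burgisser2000, Def. 2.1] -/
theorem eval_gateValues_take (P : ArithCircuit k σ) (i : ℕ) (u : Operand k σ) :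
    u.eval (gateValues (P.gates.take i)) = P.opVal i u := by
  cases u with
  | var v => rfl
  | const c => rfl
  | gate j =>
    change (gateValues (P.gates.take i)).getD j 0 = if j < i then P.gateVal j else 0
    rw [gateValues_take_eq_take, List.getD_eq_getElem?_getD, List.getElem?_take]
    split_ifs with h
    · rw [gateVal, List.getD_eq_getElem?_getD]
    · rfl

/-- **A product gate computes the product of the values of its operands**
(Bürgisser 2000, Def. 2.1). [cite: Burgisser2000, Def. 2.1] -/
theorem gateVal_of_prod (P : ArithCircuit k σ) {i : ℕ} {args : List (Operand k σ)}
    (hg : P.gates[i]? = some (.prod args)) : P.gateVal i = (args.map (P.opVal i)).prod := by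
  unfold gateVal
  rw [List.getD_eq_getElem?_getD, gateValues_getElem? P.gates i _ hg, Option.getD_some,
    Gate.eval]
  congr 1
  exact List.map_congr_left fun u _ => eval_gateValues_take P i u

/-- **A sum gate computes the weighted sum of the values of its operands**
(Bürgisser 2000, Def. 2.1). [cite: Burgisser2000, Def. 2.1] -/
theorem gateVal_of_sum (P : ArithCircuit k σ) {i : ℕ} {args : List (k × Operand k σ)}
    (hg : P.gates[i]? = some (.sum args)) :
    P.gateVal i = (args.map fun a => a.1 • P.opVal i a.2).sum := by
  unfold gateVal
  rw [List.getD_eq_getElem?_getD, gateValues_getElem? P.gates i _ hg, Option.getD_some,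
    Gate.eval]
  congr 1
  exact List.map_congr_left fun a _ => by rw [eval_gateValues_take]

/-- Junk gates have value `0`. [cite: Burgisser2000, Def. 2.1] -/
theorem gateVal_of_le (P : ArithCircuit k σ) {i : ℕ} (hi : P.size ≤ i) : P.gateVal i = 0 := by
  unfold gateVal
  rw [List.getD_eq_getElem?_getD, List.getElem?_eq_none_iff.2 (by rwa [gateValues_length]),
    Option.getD_none]

/-- The polynomial computed by `P` is the value of its output operand as seen after all gates
(Bürgisser 2000, Def. 2.1). [cite: Burgisser2000, Def. 2.1] -/
theorem eval_eq_opVal_output (P : ArithCircuit k σ) : P.eval = P.opVal P.size P.output := by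
  unfold eval
  rw [← eval_gateValues_take, size, List.take_length]

/-! ### Sum closure: every gate is a linear combination of product gates, variables and `1` -/

/-- Whether gate number `j` of `P` is a product gate (`false` out of range).
[cite: LimayeSrinivasanTavenas2025, §1] -/
def gateIsProd (P : ArithCircuit k σ) (j : ℕ) : Bool :=
  match P.gates[j]? with
  | some g => g.isProd
  | none => false

omit [CommSemiring k] in
/-- A gate is a product gate iff its entry in the gate list is some `Gate.prod`.
[cite: LimayeSrinivasanTavenas2025, §1] -/
theorem gateIsProd_iff (P : ArithCircuit k σ) (j : ℕ) :
    P.gateIsProd j = true ↔ ∃ args, P.gates[j]? = some (.prod args) := by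
  unfold gateIsProd
  cases h : P.gates[j]? with
  | none => simp
  | some g =>
    cases g with
    | prod args => simp [Gate.isProd]
    | sum args => simp [Gate.isProd]

/-- The spanning family at product-depth `p`: the values of the product gates of product-depth
`≤ p` (other gates contribute `0`), the variables, and the constant `1`
(LST 2025, §7, proof of Lemma 19, eq. (1): `P_u = ∑_j α_{u,j} ∏_k P_{u,j,k}` with the `P_{u,j,k}`
computed by gates of smaller product-depth). [cite: LimayeSrinivasanTavenas2025, Lemma 19] -/
def spanFamily (P : ArithCircuit k σ) (p : ℕ) : Fin P.size ⊕ σ ⊕ Unit → MvPolynomial σ k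
  | .inl j => if P.gateIsProd j ∧ P.gatePD j ≤ p then P.gateVal j else 0
  | .inr (.inl v) => X v
  | .inr (.inr _) => 1

/-- The spanning families are monotone in the product-depth bound.
[cite: LimayeSrinivasanTavenas2025, Lemma 19] -/
theorem span_spanFamily_mono (P : ArithCircuit k σ) {p p' : ℕ} (h : p ≤ p') :
    Submodule.span k (Set.range (P.spanFamily p)) ≤
      Submodule.span k (Set.range (P.spanFamily p')) := by
  rw [Submodule.span_le]
  rintro _ ⟨x, rfl⟩
  rcases x with j | v | u
  · simp only [spanFamily, SetLike.mem_coe]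
    split_ifs with h1
    · refine Submodule.subset_span ⟨.inl j, ?_⟩
      simp only [spanFamily]
      rw [if_pos ⟨h1.1, h1.2.trans h⟩]
    · exact Submodule.zero_mem _
  · exact Submodule.subset_span ⟨.inr (.inl v), rfl⟩
  · exact Submodule.subset_span ⟨.inr (.inr u), rfl⟩

/-- **Sum closure** (LST 2025, §7, proof of Lemma 19, eq. (1)): the value of every gate `i` of
`P` is a `k`-linear combination of the values of the product gates of product-depth at most
`gatePD P i`, of the variables, and of `1` — sum gates are linear combinations of their operands,
iterate down to product gates and leaves. [cite: LimayeSrinivasanTavenas2025, Lemma 19] -/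
theorem gateVal_mem_span_spanFamily (P : ArithCircuit k σ) (i : ℕ) :
    P.gateVal i ∈ Submodule.span k (Set.range (P.spanFamily (P.gatePD i))) := by
  induction i using Nat.strong_induction_on with
  | _ i ih =>
    by_cases hi : i < P.size
    · -- case on the gate
      cases hg : P.gates[i] with
      | prod args =>
        refine Submodule.subset_span ⟨.inl ⟨i, hi⟩, ?_⟩
        have hp : P.gateIsProd i = true :=
          (P.gateIsProd_iff i).2 ⟨args, by rw [List.getElem?_eq_getElem hi, hg]⟩
        simp [spanFamily, hp]
      | sum args =>
        have hg' : P.gates[i]? = some (.sum args) := by rw [List.getElem?_eq_getElem hi, hg]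
        rw [P.gateVal_of_sum hg']
        refine list_sum_mem ?_
        intro x hx
        obtain ⟨a, ha, rfl⟩ := List.mem_map.1 hx
        refine Submodule.smul_mem _ _ ?_
        obtain ⟨c, u⟩ := a
        cases u with
        | var v => exact Submodule.subset_span ⟨.inr (.inl v), rfl⟩
        | const c' =>
          rw [opVal_const, ← mul_one (MvPolynomial.C c'), C_mul']
          exact Submodule.smul_mem _ _ (Submodule.subset_span ⟨.inr (.inr ()), rfl⟩)
        | gate j =>
          rw [opVal_gate]
          split_ifs with hji
          · have hpd : P.gatePD j ≤ P.gatePD i := by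
              have := P.opPD_le_gatePD_of_sum hg' ha
              simpa [opPD, hji] using this
            exact P.span_spanFamily_mono hpd (ih j hji)
          · exact Submodule.zero_mem _
    · rw [P.gateVal_of_le (not_lt.1 hi)]
      exact Submodule.zero_mem _

/-- An entry `inl j` of `spanFamily P p` is either `0` or the value of a product gate `j` with
`gatePD P j ≤ p`. [cite: LimayeSrinivasanTavenas2025, Lemma 19] -/
theorem spanFamily_inl_eq (P : ArithCircuit k σ) (p : ℕ) (j : Fin P.size) :
    P.spanFamily p (.inl j) = 0 ∨
      (∃ args, P.gates[(j : ℕ)]? = some (.prod args)) ∧ P.gatePD j ≤ p ∧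
        P.spanFamily p (.inl j) = P.gateVal j := by
  simp only [spanFamily]
  split_ifs with h
  · exact Or.inr ⟨(P.gateIsProd_iff j).1 h.1, h.2, rfl⟩
  · exact Or.inl rfl

end GateData

end ArithCircuit

end Literature.Computability.AlgebraicComplexity
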